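import Summits.BirchSwinnertonDyer.BirchSwinnertonDyer.Theorems.AlignedTransportAtTwoMainConjectureTransportAlignedAtTwoDeltaPosJacobianLevel
import Summits.BirchSwinnertonDyer.BirchSwinnertonDyer.Theorems.AlignedTransportAtTwoMainConjectureTransportAlignedAtTwoDeltaPosJacobianLevelHecke
import Summits.BirchSwinnertonDyer.BirchSwinnertonDyer.Theorems.AlignedTransportAtTwoMainConjectureTransportAlignedAtTwoDeltaPosParityLinkDepleted
import Summits.BirchSwinnertonDyer.BirchSwinnertonDyer.Theorems.AlignedTransportAtTwoMainConjectureTransportAlignedAtTwoDeltaPosEngine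
import Summits.BirchSwinnertonDyer.BirchSwinnertonDyer.Theorems.AlignedTransportAtTwoMainConjectureTransportAlignedAtTwoKilfordStratum
import HarnessLib

/-!
# Crux C1 `MainConjectureTransportAlignedAtTwo` (stmt-BirchSwinnertonDyer-22296), line `birth`, plan «deltapos-galois» step (G4): THE UNEQUAL-CONDUCTOR
# ASSEMBLY — the `λ`-law of `stub_lamLawDeltaPos` for ALL conductors, modulo a `ℚ`-structure carrier WITH FORMS at the depleted level (T1⁺, taken as
# abstract hypotheses), the two odd Manin constants (T4) and three PRINT facts (width seat att-p3 g14; `--supports 22296`)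

THEOREMS ONLY (no `def`, no named fact, no `sorry`). CONDITIONAL, as hypotheses, on: the PRINT facts `heckeSelfDual_torsionBy_J0` (DDT Lemma 1.38),
`buzzard2000_multiplicityOne_gamma0` (Buzzard 2000 Prop. 2.4), `realPeriodRat_eq_unit_mul_plusPeriod_two` (plus period unit at `2`); parametrisation data
`D₁ D₂` at the two conductor levels with ODD Manin constants (T4: Abbes–Ullmo Thm A + odd-isogeny transport, Kriz–Li 2019 §5 — a folklore composite);
and the typing ask T1⁺ in ABSTRACT form: at the depleted level `N' = N₁N₂·∏_{ℓ∣N₁N₂}ℓ²`, two additive maps `Φᵢ : J0 N' →+ Wᵢ(ℂ)` with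
`Φᵢ [y] = uᵢ(cᵢ·D_S·y(gᵢ))` (`gᵢ` the `S`-depleted forms; these ARE `Dᵢ.jacobiMapForm N' (D_S·gᵢ)` of the reviewed carrier
`Literature/…/ModularJacobianGaloisDataWithForms.lean`, p669569) and an additive Galois action `gal σ` on `J0.tors N'` making both `Γ_ℚ`-equivariant on torsion
(`hgalᵢ` = the carrier's axiom `jacobiMapForm_galAct`). BSD is not proved by this; C1 is not closed by this; `stub_lamLawDeltaPos` is NOT discharged by this
(it becomes: T1⁺ instance + T4 + PRINT).

`lamLawDeltaPos_of_abstractForms`: for `W₁, W₂` globally minimal, good ordinary at `2`, without rational `2`-torsion abscissa, `Δ(W₂) ∉ ℚ²`, `W₁` OFF the Kilford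
stratum with `Δ(W₁) > 0`, sharing a cubic field `F ∋ e₁, e₂` with `AlignedAtInfinity`; newforms `f₁ f₂`, even-branch lifts `G₁ G₂`; ANY conductors:
`λ(G₁) + Σ_{ℓ ∣ N₁N₂ odd} e_ℓ(W₁) = λ(G₂) + Σ e_ℓ(W₂)` — the conclusion of `stub_lamLawDeltaPos` VERBATIM (its `AlignedAtTwo`, non-twist and `Δ(W₁) ∉ ℚ²`
binders are idle). The equal-conductor twin with the T1 carrier is att-p4 g13's `…DeltaPosCongruence.lamLawDeltaPos_of_conductorNorm_eq`.

COMPOSITION (every brick `--supports 22296`): for a cycle `x ∈ H₁(X₀(N');ℤ)`,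
* (G4 Galois) `…DeltaPosJacobianLevel.half_transport_link` (this seat, p669108): `Φ₁[x/2] = ι P ⟹ Φ₂[x/2] = ι (e P)`, `e` THE equivariant iso, with side
  inputs `…DeltaPosJacobianLevelHecke` (Hecke / `U_q` kernels from the depleted eigen-relations of `…StarLevel.exists_depleted_eigenform_of_dvd`, `a_q`-parity
  from the shared cubic field; non-vanishing from the `μ = 0` theorem), K4 at level `N'` (att-p4 g11 `…BuzzardKFour`), `Δ(W₁) ∉ ℚ₂²` from
  `…KilfordStratum.forall_sq_ne_of_not_onKilfordStratumAtTwo`;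
* (K2-depleted)∘(G2) `…DeltaPosParityLinkDepleted.even_depletedPlusValue_iff_of_link` (this seat, p668720): the link ⟹ the two integer depleted plus values
  `(2D_S/Ω⁺(fᵢ))·re x(gᵢ)` have the same parity;
* the depleted engine `…DeltaPosEngine.lamLaw_of_depleted_periodFunctionals_congr_of_sharedCubicField` (att-p4 g13, p666668).

References: Greenberg–Vatsal 2000 Thm. (1.4); Darmon–Diamond–Taylor 1995 §1.5–§1.7, Lemma 1.38; Buzzard 2000 Prop. 2.4; Atkin–Lehner 1970 §3; Cremona 1997
§2.8–§2.10; Abbes–Ullmo 1996 Thm A; Kriz–Li 2019 §5; Matsuno 2008 Thm. 4.2.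
-/

noncomputable section

-- justification: the `Summit.BirchSwinnertonDyer.BirchSwinnertonDyer.…` path repeats a component (route-file convention)
set_option linter.dupNamespace false
set_option autoImplicit false

open scoped MatrixGroups ModularForm NumberField Classical
open CongruenceSubgroup Complex WeierstrassCurve IsDedekindDomain Polynomial Module
open Literature.NumberTheory.EllipticCurves Literature.NumberTheory.EllipticCurves.ModularForms
open Literature.NumberTheory.EllipticCurves.Greenberg1999 Literature.NumberTheory.EllipticCurves.GreenbergVatsal2000
open Summit.BirchSwinnertonDyer.Rank1Residual.F1Sign2 Summit.BirchSwinnertonDyer.Rank1Residual.X1.MuLambda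
open Summit.BirchSwinnertonDyer.BirchSwinnertonDyer.Theorems.AlignedTransportAtTwoSigmaGlue
open Summit.BirchSwinnertonDyer.BirchSwinnertonDyer.Theorems.AlignedTransportAtTwoClosure
open Summit.BirchSwinnertonDyer.BirchSwinnertonDyer.Theorems.ThetaLayerLambdaCongruenceAtTwo
open Summit.BirchSwinnertonDyer.BirchSwinnertonDyer.Theorems.AlignedTransportAtTwoSharedCubicTorsion
open Summit.BirchSwinnertonDyer.BirchSwinnertonDyer.Theorems.AlignedTransportAtTwoDeltaPosFunctionalDepleted
open Summit.BirchSwinnertonDyer.BirchSwinnertonDyer.Theorems.AlignedTransportAtTwoDeltaPosAlignmentComplex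
open Summit.BirchSwinnertonDyer.BirchSwinnertonDyer.Theorems.AlignedTransportAtTwoDeltaPosParityLinkDepleted
open Summit.BirchSwinnertonDyer.BirchSwinnertonDyer.Theorems.AlignedTransportAtTwoDeltaPosJacobianLevel
open Summit.BirchSwinnertonDyer.BirchSwinnertonDyer.Theorems.AlignedTransportAtTwoDeltaPosJacobianLevelHecke
open Summit.BirchSwinnertonDyer.BirchSwinnertonDyer.Theorems.AlignedTransportAtTwoDeltaPosEngine
open Summit.BirchSwinnertonDyer.BirchSwinnertonDyer.Theorems.AlignedTransportAtTwoKilfordStratum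

namespace Summit.BirchSwinnertonDyer.BirchSwinnertonDyer.Theorems.AlignedTransportAtTwoDeltaPosCongruenceLevel

/-- **(G4) THE UNEQUAL-CONDUCTOR ASSEMBLY of the `λ`-law on the `Δ > 0` cell**, modulo T1⁺ (abstract `Φ₁ Φ₂ gal` with `hΦᵢ`, `hgalᵢ`), T4 (data `D₁ D₂` at the
conductor levels with odd Manin constants) and PRINT (`hSD`, `hBz`, `hΩu`). See the module docstring. [cite: GreenbergVatsal2000, Thm. (1.4) and §3]
[cite: DarmonDiamondTaylor1995, §1.5 and §1.7] [cite: Buzzard2000LevelLoweringModTwo, Prop. 2.4] [cite: AtkinLehner1970, §3] -/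
theorem lamLawDeltaPos_of_abstractForms
    -- PRINT
    (hSD : heckeSelfDual_torsionBy_J0) (hBz : buzzard2000_multiplicityOne_gamma0) (hΩu : realPeriodRat_eq_unit_mul_plusPeriod_two)
    -- the pair (binders of `stub_lamLawDeltaPos` that are used)
    (W₁ : WeierstrassCurve ℚ) [W₁.IsElliptic] [W₁.IsGloballyMinimal]
    (W₂ : WeierstrassCurve ℚ) [W₂.IsElliptic] [W₂.IsGloballyMinimal]
    (hord₁ : IsOrdinaryAt W₁ 2) (hord₂ : IsOrdinaryAt W₂ 2)
    (ht₁ : ∀ x : ℚ, ¬ HasRationalTwoTorsionX W₁ x) (ht₂ : ∀ x : ℚ, ¬ HasRationalTwoTorsionX W₂ x)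
    (hsq₂ : ¬ IsSquare W₂.Δ) (hK : ¬ OnKilfordStratumAtTwo W₁) (hΔ : 0 < W₁.Δ)
    {F : Type} [Field F] [NumberField F] (hF : finrank ℚ F = 3)
    {e₁ e₂ : F} (he₁ : aeval e₁ (twoDivisionUCubic W₁) = 0) (he₂ : aeval e₂ (twoDivisionUCubic W₂) = 0)
    (hal : AlignedAtInfinity F (twoDivisionUCubic W₁) (twoDivisionUCubic W₂) e₁ e₂)
    [NeZero (W₁.conductorNorm ℤ)] [NeZero (W₂.conductorNorm ℤ)]
    {f₁ : CuspForm (Gamma0 (W₁.conductorNorm ℤ)) 2} (hf₁ : IsNewformOf W₁ f₁)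
    {f₂ : CuspForm (Gamma0 (W₂.conductorNorm ℤ)) 2} (hf₂ : IsNewformOf W₂ f₂)
    {G₁ G₂ : IwasawaAlgebra 2} (hG₁ : IsEvenBranchLiftAtTwo W₁ f₁ G₁) (hG₂ : IsEvenBranchLiftAtTwo W₂ f₂ G₂)
    -- T4: data at the conductor levels with odd Manin constants
    (D₁ : ModularParametrizationData W₁ (W₁.conductorNorm ℤ)) (D₂ : ModularParametrizationData W₂ (W₂.conductorNorm ℤ))
    (hc₁ : Odd D₁.c) (hc₂ : Odd D₂.c)
    -- the depleted level and forms (existence: `…StarLevel.exists_depleted_eigenform_of_dvd`)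
    (SS : Finset ℕ) (hSS : SS = (W₁.conductorNorm ℤ * W₂.conductorNorm ℤ).primeFactors.erase 2)
    (N' : ℕ) [NeZero N'] (hN' : N' = W₁.conductorNorm ℤ * W₂.conductorNorm ℤ * ∏ ℓ ∈ SS, ℓ ^ 2)
    (g₁ g₂ : CuspForm (Gamma0 N') 2)
    (hg₁ : ∀ n : ℕ, cuspCoeff g₁ n = if ∃ ℓ ∈ SS, ℓ ∣ n then 0 else cuspCoeff f₁ n)
    (hg₂ : ∀ n : ℕ, cuspCoeff g₂ n = if ∃ ℓ ∈ SS, ℓ ∣ n then 0 else cuspCoeff f₂ n)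
    -- T1⁺ in abstract form: the two Jacobi maps of the forms `D_S·gᵢ` and a Galois action making them equivariant on torsion
    (ι : AlgebraicClosure ℚ →+* ℂ)
    (Φ₁ : J0 N' →+ (W₁.baseChange ℂ).toAffine.Point) (Φ₂ : J0 N' →+ (W₂.baseChange ℂ).toAffine.Point)
    (hΦ₁ : ∀ y : Module.Dual ℂ (CuspForm (Gamma0 N') 2),
      Φ₁ (Submodule.Quotient.mk y) = D₁.uniformize ((D₁.c : ℂ) * (((∏ ℓ ∈ SS, ℓ ^ 2 : ℕ) : ℂ) * y g₁)))
    (hΦ₂ : ∀ y : Module.Dual ℂ (CuspForm (Gamma0 N') 2),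
      Φ₂ (Submodule.Quotient.mk y) = D₂.uniformize ((D₂.c : ℂ) * (((∏ ℓ ∈ SS, ℓ ^ 2 : ℕ) : ℂ) * y g₂)))
    (gal : Field.absoluteGaloisGroup ℚ → (J0.tors N' →+ J0.tors N'))
    (hgal₁ : ∀ (σ : Field.absoluteGaloisGroup ℚ) (y : J0.tors N') (P : W₁.geomPoints),
      Φ₁ (y : J0 N') = W₁.geomPointsToComplex ι P → Φ₁ ((gal σ y : J0.tors N') : J0 N') = W₁.geomPointsToComplex ι (σ • P))
    (hgal₂ : ∀ (σ : Field.absoluteGaloisGroup ℚ) (y : J0.tors N') (P : W₂.geomPoints),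
      Φ₂ (y : J0 N') = W₂.geomPointsToComplex ι P → Φ₂ ((gal σ y : J0.tors N') : J0 N') = W₂.geomPointsToComplex ι (σ • P)) :
    lam G₁ + ∑ ℓ ∈ (W₁.conductorNorm ℤ * W₂.conductorNorm ℤ).primeFactors.erase 2, lambdaCorrectionAtTwo W₁ ℓ =
      lam G₂ + ∑ ℓ ∈ (W₁.conductorNorm ℤ * W₂.conductorNorm ℤ).primeFactors.erase 2, lambdaCorrectionAtTwo W₂ ℓ := by
  -- §0 the two odd conductors, the newforms ARE the data's newforms
  have hN₁0 : W₁.conductorNorm ℤ ≠ 0 := NeZero.ne _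
  have hN₂0 : W₂.conductorNorm ℤ ≠ 0 := NeZero.ne _
  have h2N₁ : ¬ 2 ∣ W₁.conductorNorm ℤ := not_dvd_level_of_isNewformOf hf₁ hord₁.1
  have h2N₂ : ¬ 2 ∣ W₂.conductorNorm ℤ := not_dvd_level_of_isNewformOf hf₂ hord₂.1
  have hirr₁ := irr_two_of_forall_not_hasRationalTwoTorsionX W₁ ht₁
  have hirr₂ := irr_two_of_forall_not_hasRationalTwoTorsionX W₂ ht₂
  have hfD₁ : D₁.f = f₁ := eq_of_forall_cuspCoeff_eq_gamma0 fun n ↦ by rw [D₁.isNewformOf.2 n, hf₁.2 n]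
  have hfD₂ : D₂.f = f₂ := eq_of_forall_cuspCoeff_eq_gamma0 fun n ↦ by rw [D₂.isNewformOf.2 n, hf₂.2 n]
  have hΔ₁ : ∀ s : ℚ_[2], s ^ 2 ≠ (W₁.Δ : ℚ_[2]) := forall_sq_ne_of_not_onKilfordStratumAtTwo W₁ hord₁ hK
  have hΔ₂pos : 0 < W₂.Δ := discr_pos_of_sharedCubicField D₁ ι hF ht₁ ht₂ he₁ he₂ hΔ
  -- the plus period units (PRINT), in the currency of the data's newforms `Dᵢ.f = fᵢ`
  obtain ⟨u₁, hu₁, hΩ₁⟩ := hΩu W₁ hord₁.1 hirr₁ D₁.f D₁.isNewformOf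
  obtain ⟨u₂, hu₂, hΩ₂⟩ := hΩu W₂ hord₂.1 hirr₂ D₂.f D₂.isNewformOf
  -- §1 `M = N₁N₂`, the odd places `l` realising `SS`, `D = ∏ ℓ²`, `N' = M·D` odd
  set M : ℕ := W₁.conductorNorm ℤ * W₂.conductorNorm ℤ with hM
  have hM0 : M ≠ 0 := mul_ne_zero hN₁0 hN₂0
  have h2M : ¬ 2 ∣ M := fun h ↦ ((Nat.Prime.dvd_mul Nat.prime_two).mp h).elim h2N₁ h2N₂
  obtain ⟨S, hS2, himg⟩ := exists_oddPlaces M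
  set l := S.toList with hl
  have hlnd : l.Nodup := S.nodup_toList
  have hl2 : ∀ v ∈ l, Rat.HeightOneSpectrum.natGenerator v ≠ 2 := fun v hv ↦ hS2 v (Finset.mem_toList.mp hv)
  have hSSl : SS = (l.map Rat.HeightOneSpectrum.natGenerator).toFinset := by
    rw [hSS, ← himg]; ext ℓ
    simp only [hl, List.mem_toFinset, List.mem_map, Finset.mem_toList, Finset.mem_image]
  subst hSSl
  set SS : Finset ℕ := (l.map Rat.HeightOneSpectrum.natGenerator).toFinset with hSSdef
  have hSSeq : SS = M.primeFactors.erase 2 := hSS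
  have hSSp : ∀ ℓ ∈ SS, ℓ.Prime := fun ℓ hℓ ↦
    Nat.prime_of_mem_primeFactors (Finset.mem_of_mem_erase (hSSeq ▸ hℓ))
  have hSS2' : ∀ ℓ ∈ SS, ℓ ≠ 2 := fun ℓ hℓ ↦ Finset.ne_of_mem_erase (hSSeq ▸ hℓ)
  have hSSdvd : ∀ ℓ ∈ SS, ℓ ∣ M := fun ℓ hℓ ↦ Nat.dvd_of_mem_primeFactors (Finset.mem_of_mem_erase (hSSeq ▸ hℓ))
  set D : ℕ := ∏ ℓ ∈ SS, ℓ ^ 2 with hD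
  have hD0 : D ≠ 0 := Finset.prod_ne_zero_iff.mpr fun ℓ hℓ ↦ pow_ne_zero _ (hSSp ℓ hℓ).ne_zero
  have h2D : ¬ 2 ∣ D := by
    intro h
    obtain ⟨ℓ, hℓ, hℓ2⟩ := (Nat.prime_two.prime.dvd_finsetProd_iff _).mp h
    exact hSS2' ℓ hℓ ((Nat.prime_dvd_prime_iff_eq Nat.prime_two (hSSp ℓ hℓ)).mp (Nat.prime_two.dvd_of_dvd_pow hℓ2)).symm
  have hN'MD : N' = M * D := hN'
  have h2N' : ¬ 2 ∣ N' := fun h ↦ ((Nat.Prime.dvd_mul Nat.prime_two).mp (hN'MD ▸ h)).elim h2M h2D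
  have hN'odd : Odd N' := Nat.odd_iff.mpr (Nat.two_dvd_ne_zero.mp h2N')
  have hNL₁ : W₁.conductorNorm ℤ * D ∣ N' := ⟨W₂.conductorNorm ℤ, by rw [hN'MD, hM]; ring⟩
  have hNL₂ : W₂.conductorNorm ℤ * D ∣ N' := ⟨W₁.conductorNorm ℤ, by rw [hN'MD, hM]; ring⟩
  have hN₁N' : W₁.conductorNorm ℤ ∣ N' := (dvd_mul_right _ D).trans hNL₁
  have hN₂N' : W₂.conductorNorm ℤ ∣ N' := (dvd_mul_right _ D).trans hNL₂
  have hLS : ∀ p : ℕ, p.Prime → p ∣ N' → p ∈ SS := by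
    intro p hp hpN
    rw [hN'MD] at hpN
    rcases (Nat.Prime.dvd_mul hp).mp hpN with h | h
    · rw [hSSeq]
      refine Finset.mem_erase.mpr ⟨?_, Nat.mem_primeFactors.mpr ⟨hp, h, hM0⟩⟩
      rintro rfl; exact h2M h
    · obtain ⟨ℓ, hℓ, hℓp⟩ := (hp.prime.dvd_finsetProd_iff _).mp h
      rwa [(Nat.prime_dvd_prime_iff_eq hp (hSSp ℓ hℓ)).mp (hp.dvd_of_dvd_pow hℓp)]
  have hnotSS : ∀ q : ℕ, q.Prime → ¬ q ∣ N' → q ∉ SS := fun q _ hq hmem ↦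
    hq ((hSSdvd q hmem).trans (hN'MD ▸ dvd_mul_right M D))
  have hgood₁ : ∀ v : HeightOneSpectrum (𝓞 ℚ), ¬ ((Rat.HeightOneSpectrum.primesEquiv v : ℕ) ∣ 2 * N') →
      W₁.HasGoodReductionAt v := by
    intro v hv
    by_contra hbad
    exact hv (dvd_mul_of_dvd_right (((WeierstrassCurve.dvd_conductorNorm_iff (W := W₁) v).mpr hbad).trans hN₁N') 2)
  -- §2 the depleted eigenforms at level `N'` ARE the given `g₁, g₂`: Hecke eigen-relations off `SS`, `U_ℓ gᵢ = 0` on `SS`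
  have hint₁ : ∀ n : ℕ, ∃ z : ℤ, cuspCoeff f₁ n = z := fun n ↦ ⟨W₁.LFunction n, hf₁.2 n⟩
  have hint₂ : ∀ n : ℕ, ∃ z : ℤ, cuspCoeff f₂ n = z := fun n ↦ ⟨W₂.LFunction n, hf₂.2 n⟩
  have hTf₁ : ∀ (p : ℕ) (hp : p.Prime),
      (haveI : NeZero p := ⟨hp.ne_zero⟩; heckeT (Gamma0 (W₁.conductorNorm ℤ)) 2 p f₁) = cuspCoeff f₁ p • f₁ :=
    fun p hp ↦ by haveI : NeZero p := ⟨hp.ne_zero⟩; exact hf₁.1.heckeT_eq_coeff_smul hp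
  have hTf₂ : ∀ (p : ℕ) (hp : p.Prime),
      (haveI : NeZero p := ⟨hp.ne_zero⟩; heckeT (Gamma0 (W₂.conductorNorm ℤ)) 2 p f₂) = cuspCoeff f₂ p • f₂ :=
    fun p hp ↦ by haveI : NeZero p := ⟨hp.ne_zero⟩; exact hf₂.1.heckeT_eq_coeff_smul hp
  obtain ⟨g₁', hg₁'', -, -, -, hgT₁, hgU₁, -⟩ := exists_depleted_eigenform_of_dvd f₁ hint₁ hf₁.1.2.2 hTf₁ SS hSSp N' hNL₁
    (fun p hp hpN ↦ Or.inr (hLS p hp hpN))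
  obtain ⟨g₂', hg₂'', -, -, -, hgT₂, hgU₂, -⟩ := exists_depleted_eigenform_of_dvd f₂ hint₂ hf₂.1.2.2 hTf₂ SS hSSp N' hNL₂
    (fun p hp hpN ↦ Or.inr (hLS p hp hpN))
  obtain rfl : g₁ = g₁' := eq_of_forall_cuspCoeff_eq_gamma0 fun n ↦ by rw [hg₁ n, hg₁'' n]
  obtain rfl : g₂ = g₂' := eq_of_forall_cuspCoeff_eq_gamma0 fun n ↦ by rw [hg₂ n, hg₂'' n]
  -- `q`-expansions against the data's newforms
  have hg₁D : ∀ n : ℕ, cuspCoeff g₁ n = if ∃ ℓ ∈ SS, ℓ ∣ n then 0 else cuspCoeff D₁.f n := fun n ↦ by rw [hg₁ n, hfD₁]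
  have hg₂D : ∀ n : ℕ, cuspCoeff g₂ n = if ∃ ℓ ∈ SS, ℓ ∣ n then 0 else cuspCoeff D₂.f n := fun n ↦ by rw [hg₂ n, hfD₂]
  -- integer eigen-relations `T_q gᵢ = a_q(Wᵢ) • gᵢ` off `N'`
  have hTg₁ : ∀ (q : ℕ) (hq : q.Prime), ¬ q ∣ N' →
      (haveI : NeZero q := ⟨hq.ne_zero⟩; heckeT (Gamma0 N') 2 q g₁) = ((W₁.LFunction q : ℤ) : ℂ) • g₁ := by
    intro q hq hqN; rw [hgT₁ q hq (hnotSS q hq hqN), hf₁.2 q]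
  have hTg₂ : ∀ (q : ℕ) (hq : q.Prime), ¬ q ∣ N' →
      (haveI : NeZero q := ⟨hq.ne_zero⟩; heckeT (Gamma0 N') 2 q g₂) = ((W₂.LFunction q : ℤ) : ℂ) • g₂ := by
    intro q hq hqN; rw [hgT₂ q hq (hnotSS q hq hqN), hf₂.2 q]
  -- §3 side inputs of the Galois transport for `Φᵢ`
  have hΦ₁' : ∀ y : Module.Dual ℂ (CuspForm (Gamma0 N') 2),
      Φ₁ (Submodule.Quotient.mk y) = D₁.uniformize (((D₁.c : ℂ) * (D : ℂ)) * y g₁) := fun y ↦ by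
    rw [hΦ₁, mul_assoc]
  have hΦ₂' : ∀ y : Module.Dual ℂ (CuspForm (Gamma0 N') 2),
      Φ₂ (Submodule.Quotient.mk y) = D₂.uniformize (((D₂.c : ℂ) * (D : ℂ)) * y g₂) := fun y ↦ by
    rw [hΦ₂, mul_assoc]
  have hmem₁ : ∀ x ∈ periodHomology N', ((D₁.c : ℂ) * (D : ℂ)) * x g₁ ∈ D₁.L.lattice := fun x hx ↦ by
    rw [mul_assoc]; exact maninConstant_mul_prodSq_mul_eval_depleted_mem D₁ SS hSSp N' hNL₁ g₁ hg₁D hx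
  have hmem₂ : ∀ x ∈ periodHomology N', ((D₂.c : ℂ) * (D : ℂ)) * x g₂ ∈ D₂.L.lattice := fun x hx ↦ by
    rw [mul_assoc]; exact maninConstant_mul_prodSq_mul_eval_depleted_mem D₂ SS hSSp N' hNL₂ g₂ hg₂D hx
  have hΦ₁half : ∀ x ∈ periodHomology N', Φ₁ (Submodule.Quotient.mk ((2 : ℂ)⁻¹ • x)) =
      D₁.uniformize ((D₁.c : ℂ) * ((D : ℂ) * x g₁) / 2) := fun x _ ↦ by
    rw [hΦ₁, LinearMap.smul_apply, smul_eq_mul]; congr 1; ring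
  have hΦ₂half : ∀ x ∈ periodHomology N', Φ₂ (Submodule.Quotient.mk ((2 : ℂ)⁻¹ • x)) =
      D₂.uniformize ((D₂.c : ℂ) * ((D : ℂ) * x g₂) / 2) := fun x _ ↦ by
    rw [hΦ₂, LinearMap.smul_apply, smul_eq_mul]; congr 1; ring
  -- (a) Hecke kernels off `N'`: `a_q`-parity from the shared cubic field (and both `a₂` odd)
  have hpar : ∀ (q : ℕ), q.Prime → ¬ q ∣ N' → ∃ k : ℤ, W₂.LFunction q - W₁.LFunction q = 2 * k := by
    intro q hq hqN
    have heven : Even (W₂.LFunction q - W₁.LFunction q) := by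
      by_cases hq2 : q = 2
      · subst hq2
        have ho₁ : Odd (W₁.frobeniusTrace 2) :=
          Int.not_even_iff_odd.mp fun h ↦ hord₁.2 (by exact_mod_cast even_iff_two_dvd.mp h)
        have ho₂ : Odd (W₂.frobeniusTrace 2) :=
          Int.not_even_iff_odd.mp fun h ↦ hord₂.2 (by exact_mod_cast even_iff_two_dvd.mp h)
        rw [LFunction_apply_prime_eq_frobeniusTrace W₁ 2 hord₁.1, LFunction_apply_prime_eq_frobeniusTrace W₂ 2 hord₂.1]
        exact Odd.sub_odd ho₂ ho₁
      · exact even_LFunction_sub_of_sharedCubicField W₂ W₁ hF ht₂ ht₁ he₂ he₁ hq hq2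
          (fun h ↦ hqN (h.trans hN₂N')) (fun h ↦ hqN (h.trans hN₁N'))
    obtain ⟨r, hr⟩ := heven
    exact ⟨r, by rw [hr]; ring⟩
  have hT₁ : ∀ (q : ℕ) (hq : q.Prime), ¬ q ∣ N' → ∀ x ∈ periodHomology N',
      Φ₁ (Submodule.Quotient.mk ((2 : ℂ)⁻¹ •
        ((haveI : NeZero q := ⟨hq.ne_zero⟩; heckeT (Gamma0 N') 2 q).dualMap x - (W₁.LFunction q : ℂ) • x))) = 0 := by
    intro q hq hqN x hx
    exact apply_half_hecke_sub_eq_zero_of_eigen D₁ g₁ _ Φ₁ hΦ₁' hmem₁ hq (hTg₁ q hq hqN) (k := 0) (by ring) hx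
  have hT₂ : ∀ (q : ℕ) (hq : q.Prime), ¬ q ∣ N' → ∀ x ∈ periodHomology N',
      Φ₂ (Submodule.Quotient.mk ((2 : ℂ)⁻¹ •
        ((haveI : NeZero q := ⟨hq.ne_zero⟩; heckeT (Gamma0 N') 2 q).dualMap x - (W₁.LFunction q : ℂ) • x))) = 0 := by
    intro q hq hqN x hx
    obtain ⟨k, hk⟩ := hpar q hq hqN
    exact apply_half_hecke_sub_eq_zero_of_eigen D₂ g₂ _ Φ₂ hΦ₂' hmem₂ hq (hTg₂ q hq hqN) hk hx
  -- (b) `U_q`-kernels on `N'`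
  have hU₁ : ∀ (q : ℕ) (hq : q.Prime), q ∣ N' → ∀ x ∈ periodHomology N',
      Φ₁ (Submodule.Quotient.mk ((2 : ℂ)⁻¹ • (haveI : NeZero q := ⟨hq.ne_zero⟩; heckeT (Gamma0 N') 2 q).dualMap x)) = 0 :=
    fun q hq hqN x _ ↦ apply_half_hecke_eq_zero_of_kill D₁ g₁ _ Φ₁ hΦ₁' hq (hgU₁ q hq (hLS q hq hqN)) x
  have hU₂ : ∀ (q : ℕ) (hq : q.Prime), q ∣ N' → ∀ x ∈ periodHomology N',
      Φ₂ (Submodule.Quotient.mk ((2 : ℂ)⁻¹ • (haveI : NeZero q := ⟨hq.ne_zero⟩; heckeT (Gamma0 N') 2 q).dualMap x)) = 0 :=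
    fun q hq hqN x _ ↦ apply_half_hecke_eq_zero_of_kill D₂ g₂ _ Φ₂ hΦ₂' hq (hgU₂ q hq (hLS q hq hqN)) x
  -- (c) non-vanishing on a half-class from `μ = 0`
  have hG₁' : IsEvenBranchLiftAtTwo W₁ D₁.f G₁ := hfD₁ ▸ hG₁
  have hG₂' : IsEvenBranchLiftAtTwo W₂ D₂.f G₂ := hfD₂ ▸ hG₂
  have hnz₁ := exists_apply_half_ne_zero D₁ hord₁ ht₁ hΔ hc₁ hu₁ hΩ₁ l hlnd hl2 hN'odd hNL₁ g₁
    (fun n ↦ by rw [hg₁D n]; split_ifs <;> rfl) hTg₁ hG₁' Φ₁ hΦ₁half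
  have hnz₂ := exists_apply_half_ne_zero D₂ hord₂ ht₂ hΔ₂pos hc₂ hu₂ hΩ₂ l hlnd hl2 hN'odd hNL₂ g₂
    (fun n ↦ by rw [hg₂D n]; split_ifs <;> rfl) hTg₂ hG₂' Φ₂ hΦ₂half
  -- THE equivariant isomorphism of the shared cubic field
  obtain ⟨e, he⟩ := exists_equivariant_addEquiv_of_sharedCubicField W₁ W₂ hF ht₁ ht₂ he₁ he₂
  -- §4 THE CONGRUENCE of the depleted plus values on `H₁(X₀(N');ℤ)`: link (G4) + parity (K2-depleted)∘(G2)
  have hΛ : ∀ {x : Module.Dual ℂ (CuspForm (Gamma0 N') 2)}, x ∈ periodHomology N' → ∀ {z₁ z₂ : ℤ},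
      (2 * ((∏ ℓ ∈ SS, ℓ ^ 2 : ℕ) : ℝ) / plusPeriod f₁) * (x g₁).re = z₁ →
      (2 * ((∏ ℓ ∈ SS, ℓ ^ 2 : ℕ) : ℝ) / plusPeriod f₂) * (x g₂).re = z₂ → (Even z₁ ↔ Even z₂) := by
    intro x hx z₁ z₂ hz₁ hz₂
    rw [← hfD₁] at hz₁
    rw [← hfD₂] at hz₂
    have hlink := half_transport_link ι hSD hBz ht₁ ht₂ hΔ₁ hsq₂ D₁ D₂ SS hSSp hN'odd hNL₁ hLS hgood₁ hF he₁ he₂ g₁ g₂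
      Φ₁ Φ₂ hΦ₁half hΦ₂half gal hgal₁ hgal₂ hT₁ hT₂ hU₁ hU₂ hnz₁ hnz₂ e he hx
    exact even_depletedPlusValue_iff_of_link D₁ D₂ hF ht₁ ht₂ hsq₂ hΔ he₁ he₂ hal e he ι hc₁ hc₂ hu₁ hu₂ hΩ₁ hΩ₂
      SS hSSp N' hNL₁ hNL₂ g₁ g₂ hg₁D hg₂D hx hz₁ hz₂ hlink
  -- §5 the depleted engine
  exact lamLaw_of_depleted_periodFunctionals_congr_of_sharedCubicField W₁ W₂ hord₁ hord₂ ht₁ ht₂ hF he₁ he₂ hf₁ hf₂ hG₁ hG₂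
    SS hSSeq N' hN' g₁ g₂ hg₁ hg₂ hΛ

end Summit.BirchSwinnertonDyer.BirchSwinnertonDyer.Theorems.AlignedTransportAtTwoDeltaPosCongruenceLevel

end
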